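import Summits.BirchSwinnertonDyer.Rank1Residual.F1Sign2.DescentSignAtTwo
import Literature.NumberTheory.EllipticCurves.Rank1Residual.Predicates
import Literature.NumberTheory.EllipticCurves.Kato2004.Condition1252
import Literature.NumberTheory.EllipticCurves.BSDRootNumberSmallConductorProofs
import Literature.NumberTheory.EllipticCurves.AnalyticRank
import HarnessLib

/-!
# Cell `bsd-f1-sign2`, AN-32: THE WILD PACKET READS THE BOTTOM BIT (-an g15, MEMO-an v1.25/v1.26 §2 `#### AN-32`; Sketch_v23.lean §0–§4)

TYPER FILING (cell `bsd-f1-sign2`, seat `-ty` g10; CANDIDATES.md rows AN-32a/a′/a″/e/32/32U/32v/32b/32K/32↑ + supports 32x/32Δ/32M/32i;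
-an g15 filing ask D-an-66 «port after REF1 as `F1Sign2/WildPacketAtTwo.lean`»): the §0–§4 part of the `ANg15.WildPacket` namespace block of
`HOME/MEMO-an-data/g15/Sketch_v23.lean` 27893e8ad4461589 (= the REF1 §111-audited sha d302c424fcfb79d3 block VERBATIM — the two shas differ only by the
§5 AN-32⁺ «position» rows appended at 13:50Z, MEMO-an v1.26, which go to a sibling module after REF1's §111 amendment; -an: farm rc 0, 0 sorry;
BC7 CLEAN `g15/bc/Probe_v23*.lean`) VERBATIM under the cell namespace `…Rank1Residual.F1Sign2.WildPacket` (statement-only: `def … : Prop` + the two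
kernel glue theorems `wildTwistLaw_of_halving_doubling`, `uBottomOnPrimitiveLocus_of`; axioms standard).  Typer edits = this header,
the imports (the sketch's route-file import `…Theses.ByReductionTypeAtTwo` replaced by the Literature modules that declare its carriers:
`Rank1Residual.Predicates` (`GoodSS`), `Kato2004.Condition1252` (`ImageContainsSL2`), `BSDRootNumberSmallConductorProofs` (`shaAn`, `BSDp`),
`AnalyticRank`; `F1Sign2.DescentSignAtTwo` for `twistSelmerTwoCard`/`selmerTwoCard`/`ShaTwoTrivial`/`MeetsEgg` — route-independent), and the
REF1/REF2 sentences below.  Nothing is asserted.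
Census = BC5 WITNESS: ENGINE W kit j309252 (tag `bsd-frontier-data`; `HOME/MEMO-an-data/g15/jobW/`, SHA16SUMS.txt: `engineW_rows.jsonl`
763c002939f1cb46, `ANALYSIS-W.txt` 21f68f07c5e631a6; 539 `a = 0` slice curves × 3 wild twists; two engines per quantity: PARI `ellrank` =
mwrank 1 617/1 617, PARI `ellbsd` = Dokchitser 835/835, Hilbert-symbol `i₂` = KT/DD root-number `i₂` 1 617/1 617): trichotomy P32.0
1 211/1 211 pairs (good-ss 619 + additive 592), two-place law 406/406, parity 1 617/1 617, analytic shadow P32.3 786/786 (`β = 1` → `r_an = 0 ∧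
#Ш_an` odd 620/620; `β = 0` → rank 2: 114, or rank 0 with `#Ш_an ∈ {4: 48, 16: 3, 64: 1}`), visibility certificates 114/114, local lemma
283/283 (`Δ ≡ 5 (8)`; twins II*/II/II, `c₂ = 1`).
REF1-AUDIT §111 (refuter-bsd-f1-sign2-ref1 g10, 2026-08-28T13:43:52Z, PRE-EMPTIVE; evidence `HOME/REF1-data/b111/`, Probe111.lean 1d469922cbacc5b3 farm rc 0, e1–e4 trio; gate for D-an-66): «AN-32 rows of Sketch_v23 d302c424fcfb79d3 — `WildTwinHalvingAtTwo`, `WildTwinDoublingAtTwo`, `WildTwinBlindAtTwo`, `MinusOneTwinReadsEggAtTwo`, `ShaTwoReadByWildTwinAtTwo`, `WildVisibilityAtTwo` SURVIVE as theorem-candidates (Kramer 1981 Props. 4, 7 [p0007 L16–22, p0013 L22] + one-place Poitou–Tate count; `E(ℚ₂)[2] = 0` on minimal supersingular-at-2 models); `WildTwistLawAtTwo`, `UBottomOnPrimitiveLocusAtTwo` PROVED glue (trio); `WildTwinValueLawAtTwo`, `AdditiveUnitValueKillsSelmerTwoAtTwo` SURVIVE conjecture-grade (BSD₂ of the rank-0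 wild twin; Kato at additive 2); supports `XQuarticCriterionAtTwo`, `SupersingularDiscriminantModEightAtTwo`, `TwistSelmerModelInvarianceAtTwo`, `TwinImageContainsSL2AtTwo` theorem-grade; KILLED none; elaboration rc 0, e1–e4 (odd torsion is 2-divisible; reading twists are ±2; AN-32a ⟹ #Sel₂(E^{(2)}) = 1 on the β = 1 slice; AN-32K ⊋ its additive restriction); independent recount of ENGINE W on the 283 GoodSS curves: trichotomy 451/451, a 310/310, a′ 141/141, a″ 168/168, e 115/115, U 191/191, v 92/92 + 28/28, analytic shadow 451/451, β two engines 283/283 = ENGINE S, #Ш_an two engines 356/356, 0 violations; riders r1–r7 text-only (r1: AN-32K typed over ¬good ⊋ additive).» Typer uptake of the riders: r4 (h21 classes) — `@[conjecture]` ADDED on AN-32b `WildTwinValueLawAtTwo` and AN-32K `AdditiveUnitValueKillsSelmerTwoAtTwo` (attribute only, statements verbatim); r1 recorded in AN-32K's docstring (-an's call; a restricted row goes under a new name); r3 recorded in AN-32M's docstring (`WeierstrassCurve.finite_selmerGroup_holds`); r2 (REF1's second engine kit j309829 on the any-rank / rank-0 clauses, §111-add) and r5 (wording, -an) fold text-only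 when posted.
REF2-PLACEMENT v30 §1.5 = REF2_TXT_AN32 (refuter-bsd-f1-sign2-ref2 g30, 2026-08-28T13:53:46Z; `HOME/REF2-PLACEMENT-v30.md`): «PLACEMENT (REF2 v30 §1, 2026-08-28): -an's placement confirmed from print. AN-32a/a′/a″/e/U/v are IN-PRINT ASSEMBLY: Mazur–Rubin 2010 [MazurRubin2010, Lemma 3.1 (one-place Poitou–Tate count), Lemma 2.9, Lemma 2.10 (ii)–(v), Cor. 3.4(i)] with T = {2}, the local index at 2 supplied by Kramer 1981 [Kramer1981, Prop. 4: E supersingular at 2, ℚ₂(√δ)/ℚ₂ ramified ⇒ i₂ = 1 iff v₂(δ) odd, parity = (Δ,δ)₂; Prop. 7: N E(K_w) = intersection of the two Kummer images]; equivalently Klagsbrun–Mazur–Rubin 2013 [KlagsbrunMazurRubin2013, Thm. 3.9] (two Lagrangian lines in H¹(ℚ₂,E[2]) when E(ℚ₂)[2] = 0). Mazur–Rubin print Prop. 3.3 under "all primes above 2 split"; the ramified-supersingular place is the one unprinted sentence. Parity clause = Kramer / Dokchitser–Dokchitser 2011 (Crelle 658) Thm. 5. AN-32x = [Silverman AEC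 III.2.3(d)]; AN-32Δ = Kramer Prop. 4 ("Moreover"). AN-32b/AN-32K (BSD₂ of the additive rank-0 twin) are OPEN: Kato 2004 [Kato2004Asterisque, Thm. 14.5(3)] assumes p ≠ 2 and potentially good reduction at p; printed 2-part twist results (Zhao; Coates–Li–Tian–Zhai 2015; Cai–Li–Zhai 2020; Kriz–Li 2019 [KrizLi2019, Thm. 1.12]) are family-specific. Grade: formula VARIANT, reading (V_{2} = β = AN-31's Λ-bit; Ш(W)[2] read by the wild twin on β = 1) NEW-COMBINATION, cell-internal; beyond-print theorem: no.» Riders v30 §1.4 (text-only, none blocking): r1 cite MR 2010 by published numbering (Lemma 2.9 / 2.10 / 3.1 / Cor. 3.4(i)) and Kramer 1981 Prop. 4 (with the «Moreover» clause) + Prop. 7 — not Kramer Thm. 1 (the rows' `[cite: Kramer1981, …, Thm. 1]` tags are -an's; read them as Props. 4/7); r2 AN-32a″ checks out against print; r3 = REF1 r1 (AN-32K ⊋ additive; for placement the ADDITIVE case is the one beyond Kato 14.5(3)). [cite: MazurRubin2010, Lemma 2.9, Lemma 2.10, Lemma 3.1, Prop. 3.3, Cor. 3.4] [cite: Kramer1981,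 Prop. 4, Prop. 7] [cite: KlagsbrunMazurRubin2013, Thm. 3.9] [cite: Kato2004Asterisque, Thm. 14.5] [cite: KrizLi2019, Thm. 1.12]
PARTITION: none moved (frontier tier; AN-32U/32↑ are a Heegner-free SEED for the bottom rung of stub U of crux-23715 on `{β = 1}`, AN-32v the
visibility reading on `{β = 0}`; AN-32K is conjecture-grade = Kato at the ADDITIVE prime 2); beyond-print theorem: no.  BSD is not proved by any
of this.
bears_on: crux stmt-BirchSwinnertonDyer-23715 (line `one_door_analytic`; crux idea `wild-twin-bottom-bit`, evidence #59), crux `AdditiveRankZeroAtTwo`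
(items 19095–19098: the rank-0 additive twins `E^{(±2)}` at `64N`); asks D-an-61 (-es), D-an-62 (-desc), D-an-63 (-imc), D-an-64 (REF1),
D-an-65 (REF2), D-an-67 (lead fkl-p1/p2), D-an-68 (-data).

## The sketch's own summary (-an g15, verbatim)

# Sketch v23 (-an g15, MEMO-an v1.24 → v1.25 §2 AN-32): THE WILD PACKET READS THE BOTTOM BIT

Object.  For a curve `E/ℚ` with good SUPERSINGULAR reduction at `2` (so `E(ℚ₂)[2] = 0` and `E(ℚ₂)/2E(ℚ₂) ≅ ℤ/2`) the
**bottom bit at `2`** is `β(E) := [E(ℚ) → E(ℚ₂)/2E(ℚ₂) is non-zero]` (`LocallyPrimitiveAtTwo`; on the cell's rank-one slice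
`β = [R ∉ 2E(ℚ₂)]` for the generator `R`, ENGINE S/B column `beta`).  `β = 0` is exactly the locus where every `2`-adic-logarithm
mechanism (Kriz–Li `(★)`, BDP/Waldspurger values, `2`-adic heights) is blind (MEMO-an AN-31: `ord₂ log = m + Λ`, `Λ ≥ 2 ⟺ β = 0`), i.e. the
obstruction locus of the bottom layer of `stub_doorLowerC` of the line of record on crux `RankOneAtTwoBigImageOddLocal`.
The **wild packet** of `E` is `{E^{(−1)}, E^{(2)}, E^{(−2)}}` — the quadratic twists ramified at `2` (additive at `2`, conductor `2⁴N`,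
`2⁶N`, `2⁶N`: instances of the route's crux `AdditiveRankZeroAtTwo` when their rank is `0`).

Mechanism (in print, assembled).  On the odd-Tamagawa slice the `2`-Selmer local conditions of `E` and `E^{(δ)}`, `δ ∈ {−1, ±2}`, inside
`H¹(ℚ_v, E[2]) = H¹(ℚ_v, E^{(δ)}[2])` COINCIDE at every `v ∉ {2, ∞}` (Kramer 1981 Props. 1, 2, 7: the norm index `i_v` vanishes when
`ord_v Δ` is odd at multiplicative `v`, and `H¹(ℚ_v, E[2]) = 0` at additive odd `v` with `c_v` odd), coincide at `∞` unless `δ < 0 < Δ`,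
and at `v = 2` Kramer's Prop. 4 [corpus:paper:doi-10-1090-s0002-9947-1981-0597871-8 p7 L16–L22, verbatim: «F unramified over ℚ₂, K/F
ramified, E supersingular ⟹ i(K/F) = 0 if v(d) is even, = [F:ℚ₂] if v(d) is odd; i(K/F) is even or odd according to whether (Δ,d)_F = ±1»]
gives `i₂(−1) = 0`, `i₂(±2) = 1`: the Kummer LINES of `E` and `E^{(±2)}` in the plane `H¹(ℚ₂, E[2]) ≅ 𝔽₂²` are TRANSVERSE, those of
`E` and `E^{(−1)}` are EQUAL.  Then the Poitou–Tate count of Mazur–Rubin 2010 (Lemma 3.2 + the proof of Prop. 3.3 / Cor. 3.4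
[corpus:paper:arxiv-0904.3709 p8 L32–L170]; printed under the hypothesis «all primes above 2 split in F/K», which the wild packet
VIOLATES — the proof uses only transversality at `T`, Kramer's congruence (Kramer 1981 Thm. 1, all places) and Lemma 3.2, all valid at
`T = {2}`) gives, with `V := loc₂ Sel₂(E) ⊆ E(ℚ₂)/2E(ℚ₂) ≅ 𝔽₂`:
      `dim Sel₂(E^{(±2)}) = dim Sel₂(E) + 1 − 2·dim V`      (`δ = −2` only when `Δ < 0`),      `Sel₂(E^{(−1)}) = Sel₂(E)` (`Δ < 0`).
On the slice (`Sel₂(E) = 𝔽₂·κ(R)`): `dim V = β`, so **`#Sel₂(E^{(±2)}) = 1` if `β = 1` and `= 4` if `β = 0`** — the `2`-adic twin of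
-desc's archimedean law T-C `EggTwistLawAtTwo` (place `∞`, bit `ε = MeetsEgg`, twists `d < 0` admissible) with the dictionary
`∞ ↦ 2`, `E(ℝ)/2E(ℝ) ↦ E(ℚ₂)/2E(ℚ₂)`, `MeetsEgg ↦ LocallyPrimitiveAtTwo`, `d admissible ↦ δ = ±2`.
Kramer–Tunnell / Dokchitser–Dokchitser Thm. 5 [corpus:paper:arxiv-0906.1815 p4 L1–L12: `w(E/𝒦)w(E_α/𝒦)(−Δ_E,α)_𝒦 = (−1)^{dim E(𝒦)/N E(ℱ)}`]
computes `i₂` from root numbers for ANY reduction type (ENGINE W column `i2_KT`), which states the law for additive `E` at `2` as well (words only).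

Items (nothing asserted: `def … : Prop` + kernel glue):
* AN-32a  `WildTwinHalvingAtTwo`   (THEOREM-CANDIDATE)  `β = 1 ⟹ #Sel₂(E) = 2·#Sel₂(E^{(±2)})` — any rank, any `Ш`.
* AN-32a′ `WildTwinDoublingAtTwo`  (THEOREM-CANDIDATE)  `Ш(E)[2] = 0 ∧ β = 0 ⟹ #Sel₂(E^{(±2)}) = 2·#Sel₂(E)`.
* AN-32a″ `WildTwinBlindAtTwo`     (THEOREM-CANDIDATE)  `Δ < 0 ⟹ #Sel₂(E^{(−1)}) = #Sel₂(E)`.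
* AN-32e  `MinusOneTwinReadsEggAtTwo` (THEOREM-CANDIDATE) `Δ > 0`, rank 1, `Ш[2] = 0`: `#Sel₂(E^{(−1)}) = 1 / 4` as `E(ℚ)` meets the egg or not
          (T-C's law for the NON-admissible `d = −1`: `c₂(E^{(−1)}) = 1`, type II*, for supersingular `E` — MEMO-an AN-10 L1).
* AN-32   `WildTwistLawAtTwo` (the trichotomy on the slice; PROVED below from AN-32a + AN-32a′ by arithmetic).
* AN-32U  `ShaTwoReadByWildTwinAtTwo` (THEOREM-CANDIDATE, the U-bottom seed): rank 1, `β = 1 ⟹ (Ш(E)[2] = 0 ⟺ Sel₂(E^{(2)}) = 0)` — the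
          `2`-part of `Ш` of the rank-ONE curve is the full `2`-Selmer group of a rank-ZERO additive twin: a Kato-at-2 target, no Heegner point.
* AN-32v  `WildVisibilityAtTwo` (THEOREM-CANDIDATE corollary): `β = 0 ⟹` the twin has rank `≤ 2`, and if its rank is `0` then `Ш(E^{(2)})[2] ≠ 0`
          (in fact `≅ (ℤ/2)² ∋` the image of `κ(R)`: the Mordell–Weil generator of `E` is VISIBLE `Ш` of the additive twin at `64N`).
* AN-32K  `AdditiveUnitValueKillsSelmerTwoAtTwo` (CONJECTURE = Kato's rank-0 bound at the ADDITIVE prime 2) and AN-32↑ `UBottomOnPrimitiveLocusAtTwo`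
          (U's bottom rung on `β = 1`, PROVED from AN-32U + AN-32K + model/image supports by `uBottomOnPrimitiveLocus_of`).
* AN-32b  `WildTwinValueLawAtTwo` (CONJECTURE = AN-32 + BSD₂ of the twin, i.e. an instance of crux `AdditiveRankZeroAtTwo`): for a rank-0 twin,
          `ord₂ #Ш_an(E^{(2)}) = 0 ⟺ β = 1`, `≥ 2 ⟺ β = 0`; as `L(E^{(2)}, s) = L(E, χ₈, s)` this is the first cyclotomic layer of the `2`-adic
          L-function of `E` (MEMO-an AN-1/AN-8S) reading the bit that its `T = 0` layer (GZ/BDP/`(★)`) cannot.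
Support: AN-32x (x-coordinate criterion for `2`-divisibility, duplication formula), AN-32Δ (`Δ_min ≡ 5 (mod 8)` for supersingular `2`;
Kramer 1981 p.126, -desc MEMO §12: 1 150/1 150).
Census = ENGINE W (kit j309252, tag bsd-frontier-data; `MEMO-an-data/g15/jobW/`).  [cite: Kramer1981, Props. 1, 2, 4, 7, Thm. 1]
[cite: MazurRubin2010, Lemma 3.2, Prop. 3.3, Cor. 3.4] [cite: DokchitserDokchitser2011, Thm. 5] [cite: Monsky1996, Thm. 1.5]
-/

set_option autoImplicit false

noncomputable section

open scoped Classical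

namespace Summit.BirchSwinnertonDyer.Rank1Residual.F1Sign2.WildPacket


open Literature.NumberTheory.EllipticCurves Literature.NumberTheory.EllipticCurves.Rank1Residual
  Summit.BirchSwinnertonDyer.Rank1Residual.F1Sign2

/-! ### §0 Carriers -/

/-- The rational affine point `(x, y)` of `W` is `2`-DIVISIBLE IN `E(ℚ₂)`: some `ℚ₂`-point `S` has `2S = (x,y)`. -/
def TwoDivisibleAtTwo (W : WeierstrassCurve ℚ) (x y : ℚ) : Prop :=
  ∃ (h : (W.baseChange ℚ_[2]).toAffine.Nonsingular (x : ℚ_[2]) (y : ℚ_[2]))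
    (S : (W.baseChange ℚ_[2]).toAffine.Point), (2 : ℕ) • S = WeierstrassCurve.Affine.Point.some _ _ h

/-- **The bottom bit `β = 1`**: `E(ℚ) → E(ℚ₂)/2E(ℚ₂)` is non-zero, i.e. some rational point is not `2`-divisible `2`-adically
(the `2`-adic analogue of -desc's `MeetsEgg`: `E(ℚ) → E(ℝ)/2E(ℝ)` onto).  On the slice (rank one, `#E(ℚ)_tors` odd) this is
`R ∉ 2E(ℚ₂)` for the generator `R` (independent of the choice: `nR + T`, `n` odd, has the same bit). ENGINE S/B column `beta`. -/
def LocallyPrimitiveAtTwo (W : WeierstrassCurve ℚ) : Prop :=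
  ∃ x y : ℚ, W.toAffine.Equation x y ∧ ¬ TwoDivisibleAtTwo W x y

/-- AN-32x support: the `2`-division quartic of the abscissa `x₀` has a `ℚ₂`-root — `x([2](t,s)) = x₀` is solvable in `ℚ₂`
(duplication formula `x([2]P) = (t⁴ − b₄t² − 2b₆t − b₈)/(4t³ + b₂t² + 2b₄t + b₆)`). For a point of infinite order this is
equivalent to `TwoDivisibleAtTwo` (the sign of `y` is immaterial: `−P = 2(−Q)`; `s ∈ ℚ₂` is automatic, else `4Q = 0`). ENGINE B's test. -/
def TwoDivisionQuarticSolvableAtTwo (W : WeierstrassCurve ℚ) (x₀ : ℚ) : Prop :=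
  ∃ t : ℚ_[2], 4 * t ^ 3 + (W.b₂ : ℚ_[2]) * t ^ 2 + 2 * (W.b₄ : ℚ_[2]) * t + (W.b₆ : ℚ_[2]) ≠ 0 ∧
    t ^ 4 - (W.b₄ : ℚ_[2]) * t ^ 2 - 2 * (W.b₆ : ℚ_[2]) * t - (W.b₈ : ℚ_[2]) =
      (x₀ : ℚ_[2]) * (4 * t ^ 3 + (W.b₂ : ℚ_[2]) * t ^ 2 + 2 * (W.b₄ : ℚ_[2]) * t + (W.b₆ : ℚ_[2]))

/-- AN-32x (support, in print: Silverman AEC III.2.3(d) duplication formula; Washington §2): for a rational point of infinite order,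
`2`-divisibility in `E(ℚ₂)` is solvability of the `2`-division quartic of its abscissa. [folklore] -/
def XQuarticCriterionAtTwo : Prop :=
  ∀ (W : WeierstrassCurve ℚ) [W.IsElliptic] (x y : ℚ) (h : W.toAffine.Nonsingular x y),
    ¬ IsOfFinAddOrder (WeierstrassCurve.Affine.Point.some _ _ h) →
      (TwoDivisibleAtTwo W x y ↔ TwoDivisionQuarticSolvableAtTwo W x)

/-- AN-32Δ (support, in print: Kramer 1981 p. 126 «Δ ∈ −3·F*²» for supersingular reduction over unramified `F/ℚ₂`; -desc MEMO §12,
census 1 150/1 150; ENGINE W L32.0): a globally minimal curve with good supersingular reduction at `2` has `Δ ≡ 5 (mod 8)`. -/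
def SupersingularDiscriminantModEightAtTwo : Prop :=
  ∀ (W : WeierstrassCurve ℚ) [W.IsElliptic] [W.IsGloballyMinimal], GoodSS W 2 → ∃ k : ℤ, W.Δ = ((8 * k + 5 : ℤ) : ℚ)

/-- The wild twist parameters that change the `2`-Selmer local condition ONLY at `2` (Kramer Prop. 4: `v₂(δ)` odd; no archimedean
change: `δ > 0` or `Δ < 0`). -/
def WildReadingTwist (W : WeierstrassCurve ℚ) (δ : ℤ) : Prop := δ = 2 ∨ (δ = -2 ∧ W.Δ < 0)

/-! ### §1 The law (THEOREM-CANDIDATES by in-print assembly: Kramer 1981 Props. 1, 2, 4, 7 + Thm. 1; Mazur–Rubin 2010 L3.2/P3.3 at `T = {2}`) -/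

/-- **AN-32a `WildTwinHalvingAtTwo`.** Good supersingular at `2`, odd Tamagawa product, bottom bit `β = 1`:
`#Sel₂(E) = 2 · #Sel₂(E^{(δ)})` for `δ = 2`, and for `δ = −2` when `Δ < 0` — whatever the rank and `Ш` of `E`
(`dim Sel₂(E^{(δ)}) = dim Sel₂(E) + 1 − 2·dim loc₂ Sel₂(E)` with `loc₂ Sel₂(E) ∋ loc₂ κ(P) ≠ 0`).
Why it might fail: only through a slip in the local bookkeeping at an odd additive prime (`H¹(ℚ_ℓ, E[2]) = 0` needs `c_ℓ` odd AND
potentially-good — on the slice `c_ℓ ∈ {1,3}`); ENGINE W P32.0. [cite: Kramer1981, Prop. 4, Prop. 7, Thm. 1] [cite: MazurRubin2010, Prop. 3.3] -/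
def WildTwinHalvingAtTwo : Prop :=
  ∀ (W : WeierstrassCurve ℚ) [W.IsElliptic] [W.IsGloballyMinimal], GoodSS W 2 → Odd W.tamagawaProduct →
    LocallyPrimitiveAtTwo W → ∀ δ : ℤ, WildReadingTwist W δ → 2 * twistSelmerTwoCard W δ = selmerTwoCard W

/-- **AN-32a′ `WildTwinDoublingAtTwo`.** Good supersingular at `2`, odd Tamagawa product, `Ш(E)[2] = 0` and bottom bit `β = 0`
(every rational point `2`-divisible in `E(ℚ₂)`, so `loc₂ Sel₂(E) = 0`): `#Sel₂(E^{(δ)}) = 2 · #Sel₂(E)` for every reading `δ`.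
REF1 §111-add (third engine kit j309853, Cremona N odd < 10⁴: rank 0 1 413/1 413, rank 1 110, rank 2 4; r8): the hypothesis `ShaTwoTrivial` is
LOAD-BEARING — witness 1717a2 (rank 0, `Ш[2] ≅ (ℤ/2)²`): the `±2`-twin HALVES, `[0,0,2] ↦ [1,1,0]` (61/61 such curves); likewise at the real place for
AN-32e (19/19). [cite: Kramer1981, Prop. 4, Prop. 7, Thm. 1] [cite: MazurRubin2010, Prop. 3.3] -/
def WildTwinDoublingAtTwo : Prop :=
  ∀ (W : WeierstrassCurve ℚ) [W.IsElliptic] [W.IsGloballyMinimal], GoodSS W 2 → Odd W.tamagawaProduct →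
    ShaTwoTrivial W → ¬ LocallyPrimitiveAtTwo W → ∀ δ : ℤ, WildReadingTwist W δ → twistSelmerTwoCard W δ = 2 * selmerTwoCard W

/-- **AN-32a″ `WildTwinBlindAtTwo`.** Good supersingular at `2`, odd Tamagawa product, `Δ < 0`: the twist by `−1` has the SAME
`2`-Selmer group (`i₂(−1) = 0`: equal Kummer lines at `2`; `H¹(ℝ, E[2]) = 0`). ENGINE W: `dim Sel₂(E^{(−1)}) = 1` on every `Δ < 0` slice row.
[cite: Kramer1981, Prop. 4, Prop. 7] -/
def WildTwinBlindAtTwo : Prop :=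
  ∀ (W : WeierstrassCurve ℚ) [W.IsElliptic] [W.IsGloballyMinimal], GoodSS W 2 → Odd W.tamagawaProduct → W.Δ < 0 →
    twistSelmerTwoCard W (-1) = selmerTwoCard W

/-- **AN-32e `MinusOneTwinReadsEggAtTwo`.** Good supersingular at `2`, odd Tamagawa product, `Δ > 0`, rank one, `Ш[2] = 0`: the twist
by `−1` (NOT descent-admissible: `−1 ≢ 1 (8)`; but `i₂(−1) = 0`, so conditions differ only at `∞`) obeys -desc's egg law T-C:
`#Sel₂(E^{(−1)}) = 1` if `E(ℚ)` meets the egg, `= 4` if not.  The Selmer form of MEMO-an AN-10B on the supersingular stratum.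
[cite: Kramer1981, Prop. 4, Prop. 6, Prop. 7, Thm. 1] -/
def MinusOneTwinReadsEggAtTwo : Prop :=
  ∀ (W : WeierstrassCurve ℚ) [W.IsElliptic] [W.IsGloballyMinimal], GoodSS W 2 → Odd W.tamagawaProduct → 0 < W.Δ →
    W.mordellWeilRank = 1 → ShaTwoTrivial W →
      (MeetsEgg W → twistSelmerTwoCard W (-1) = 1) ∧ (¬ MeetsEgg W → twistSelmerTwoCard W (-1) = 4)

/-- **AN-32 `WildTwistLawAtTwo` (the trichotomy on the slice `#Sel₂(E) = 2`, `Ш(E)[2] = 0`).** For every reading `δ`: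
`#Sel₂(E^{(δ)}) = 1` if `β = 1`, `= 4` if `β = 0`.  PROVED below from AN-32a + AN-32a′. -/
def WildTwistLawAtTwo : Prop :=
  ∀ (W : WeierstrassCurve ℚ) [W.IsElliptic] [W.IsGloballyMinimal], GoodSS W 2 → Odd W.tamagawaProduct →
    selmerTwoCard W = 2 → ShaTwoTrivial W → ∀ δ : ℤ, WildReadingTwist W δ →
      (LocallyPrimitiveAtTwo W → twistSelmerTwoCard W δ = 1) ∧ (¬ LocallyPrimitiveAtTwo W → twistSelmerTwoCard W δ = 4)

/-- Kernel glue (PROVED, -an g15): AN-32a + AN-32a′ ⟹ AN-32 on the slice `#Sel₂(E) = 2`, `Ш(E)[2] = 0` (arithmetic). -/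
theorem wildTwistLaw_of_halving_doubling (h₁ : WildTwinHalvingAtTwo) (h₂ : WildTwinDoublingAtTwo) : WildTwistLawAtTwo := by
  intro W _ _ hss htam hsel hsha δ hδ
  refine ⟨fun hβ => ?_, fun hβ => ?_⟩
  · have := h₁ W hss htam hβ δ hδ; omega
  · have := h₂ W hss htam hsha hβ δ hδ; omega

/-! ### §2 What the law buys (THEOREM-CANDIDATE corollaries) -/

/-- **AN-32U `ShaTwoReadByWildTwinAtTwo` (the U-bottom seed).** Rank one, no rational `2`-torsion (automatic for supersingular `2`),
bottom bit `β = 1`: `Ш(E)[2] = 0 ⟺ Sel₂(E^{(2)}) = 0`.  (`#Sel₂(E) = 2·#Ш(E)[2]`-free form: `#Ш(E)[2] = #Sel₂(E^{(2)})`.)  So on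
the `β = 1` locus the `2`-part of `Ш` of the rank-ONE curve is decided by the `2`-Selmer group of a rank-ZERO additive curve of conductor
`64N` — a target for Kato's Euler system at `2` plus the minimality of `L(E, χ₈, 1)`, with no Heegner point and no `2`-adic logarithm.
[cite: Kramer1981, Prop. 4, Prop. 7, Thm. 1] [cite: MazurRubin2010, Prop. 3.3] -/
def ShaTwoReadByWildTwinAtTwo : Prop :=
  ∀ (W : WeierstrassCurve ℚ) [W.IsElliptic] [W.IsGloballyMinimal], GoodSS W 2 → Odd W.tamagawaProduct →
    W.mordellWeilRank = 1 → LocallyPrimitiveAtTwo W → (ShaTwoTrivial W ↔ twistSelmerTwoCard W 2 = 1)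

/-- **AN-32v `WildVisibilityAtTwo`.** Rank one, `Ш(E)[2] = 0`, `β = 0`: every globally minimal model `W₂` of `E^{(2)}` has
Mordell–Weil rank `≤ 2`, and if that rank is `0` then `Ш(W₂)[2] ≠ 0` (`#Sel₂(E^{(2)}) = 4`, `E^{(2)}(ℚ)[2] = 0`; the class `κ(R)` of
the generator of `E(ℚ)` lies in `Sel₂(E^{(2)})`: it is VISIBLE in the additive twin).  ENGINE W P32.4: both cases occur. -/
def WildVisibilityAtTwo : Prop :=
  ∀ (W : WeierstrassCurve ℚ) [W.IsElliptic] [W.IsGloballyMinimal], GoodSS W 2 → Odd W.tamagawaProduct →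
    W.mordellWeilRank = 1 → ShaTwoTrivial W → ¬ LocallyPrimitiveAtTwo W →
    ∀ (W₂ : WeierstrassCurve ℚ) [W₂.IsElliptic] [W₂.IsGloballyMinimal] (C : WeierstrassCurve.VariableChange ℚ),
      C • W.quadraticTwist (2 : ℚ) = W₂ → W₂.mordellWeilRank ≤ 2 ∧ (W₂.mordellWeilRank = 0 → ¬ ShaTwoTrivial W₂)

/-! ### §3 The analytic face (CONJECTURE-grade: AN-32 + BSD₂ of the additive twin = an instance of crux `AdditiveRankZeroAtTwo`) -/

/-- **AN-32b `WildTwinValueLawAtTwo`.** On the slice with good supersingular `2`: for a globally minimal model `W₂` of `E^{(2)}` of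
analytic rank `0`, Miller's `#Ш_an(W₂)` is a rational number whose `2`-adic valuation is `0` iff `β = 1` and `≥ 2` iff `β = 0`.
Since `L(E^{(2)}, s) = L(E, χ₈, s)`, `c₂(E^{(2)}) = 1` (type II at `2`, ENGINE W) and the odd-prime Tamagawa numbers of `E^{(2)}` stay odd,
this says: `ord₂( L(E, χ₈, 1) / Ω(E^{(2)}) ) = 0 ⟺ β = 1` — the first cyclotomic layer of the `2`-adic L-function reads the bottom bit.
ENGINE W P32.3 (both engines).  Conjecture-grade: the `⟸` directions are BSD₂ for the rank-0 additive twin.  REF1 §111: SURVIVES conjecture-grade,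
tagged `@[conjecture]` (r4, typer edit). [cite: Miller2011LMS, Def. 1.1] -/
@[conjecture] def WildTwinValueLawAtTwo : Prop :=
  ∀ (W : WeierstrassCurve ℚ) [W.IsElliptic] [W.IsGloballyMinimal], GoodSS W 2 → Odd W.tamagawaProduct →
    W.mordellWeilRank = 1 → ShaTwoTrivial W →
    ∀ (W₂ : WeierstrassCurve ℚ) [W₂.IsElliptic] [W₂.IsGloballyMinimal] (C : WeierstrassCurve.VariableChange ℚ),
      C • W.quadraticTwist (2 : ℚ) = W₂ → W₂.analyticRank = 0 →
        ∃ q : ℚ, shaAn W₂ = (q : ℂ) ∧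
          (LocallyPrimitiveAtTwo W → padicValRat 2 q = 0) ∧ (¬ LocallyPrimitiveAtTwo W → 2 ≤ padicValRat 2 q)

/-- Kernel glue: the THEOREM-grade half of AN-32b's `β = 0` clause — given AN-32v and Miller's `BSDp W₂ 2` for the rank-0 twin,
`#Ш_an(W₂)` has `2`-adic valuation `≥ 1` (indeed `Ш(W₂)[2] ≠ 0` forces `2 ∣ #Ш(W₂)[2^∞]`).  Stated as a `Prop` (the order lemma
`Ш[2] ≠ 0 ⟹ 2 ∣ #Ш[2^∞]` is left to the prover). -/
def ValueLawFromBSDpAtTwo : Prop :=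
  ∀ (W₂ : WeierstrassCurve ℚ) [W₂.IsElliptic] [W₂.IsGloballyMinimal], W₂.mordellWeilRank = 0 → ¬ ShaTwoTrivial W₂ → BSDp W₂ 2 →
    ∃ q : ℚ, shaAn W₂ = (q : ℂ) ∧ 1 ≤ padicValRat 2 q

/-! ### §4 The U-bottom seed made explicit (kernel glue): AN-32U + Kato at the ADDITIVE prime 2 for the twin ⟹ `Ш(E)[2] = 0` on `β = 1` -/

/-- AN-32M (support, model bookkeeping): -desc's `twistSelmerTwoCard W 2` (the `2`-Selmer cardinality of the raw model `W.quadraticTwist 2`) equals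
`selmerTwoCard W₂` for every globally minimal model `W₂` of the twist (`Nat.card` of the Selmer group is invariant under `VariableChange`).
REF1 §111 r3: `Nat.card (selmerGroup _ 2)` is the intended number because `Sel₂` is finite — tree theorem `WeierstrassCurve.finite_selmerGroup_holds`
(`Literature/NumberTheory/EllipticCurves/Selmer.lean`), to be invoked by provers next to this row. -/
def TwistSelmerModelInvarianceAtTwo : Prop :=
  ∀ (W : WeierstrassCurve ℚ) [W.IsElliptic] (W₂ : WeierstrassCurve ℚ) [W₂.IsElliptic] [W₂.IsGloballyMinimal]
    (C : WeierstrassCurve.VariableChange ℚ), C • W.quadraticTwist (2 : ℚ) = W₂ → twistSelmerTwoCard W 2 = selmerTwoCard W₂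

/-- AN-32i (support, group theory): if `ρ_{E,2^∞}` is onto `GL₂(ℤ₂)` then the twist `E^{(2)}` satisfies Kato's condition (12.5.2) at `2`
(`ρ_{E^{(2)}} = ρ_E ⊗ χ₈`; on `G_{ℚ(√2)}` the two agree and `ρ_E(G_{ℚ(√2)}) = det⁻¹(ker χ₈) ⊇ SL₂(ℤ₂)`, `ℚ(√2) ⊂ ℚ(μ₈)`). -/
def TwinImageContainsSL2AtTwo : Prop :=
  ∀ (W : WeierstrassCurve ℚ) [W.IsElliptic] (W₂ : WeierstrassCurve ℚ) [W₂.IsElliptic] [W₂.IsGloballyMinimal]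
    (C : WeierstrassCurve.VariableChange ℚ), C • W.quadraticTwist (2 : ℚ) = W₂ →
      (∀ n : ℕ, W.HasSurjectiveModNGaloisRep ((2 ^ n : ℕ) : ℤ)) → Kato2004.ImageContainsSL2 W₂ 2

/-- **AN-32K `AdditiveUnitValueKillsSelmerTwoAtTwo` (CONJECTURE-grade = Kato's rank-zero Euler-system bound AT THE ADDITIVE PRIME 2, mod 2;
the Selmer side of crux `AdditiveRankZeroAtTwo` on the unit locus).** For `W₂/ℚ` globally minimal, ADDITIVE at `2`, with Kato's image condition at `2`,
odd torsion, odd Tamagawa product and `L(W₂, 1)/Ω_{W₂}` a rational `2`-adic UNIT: `Sel₂(W₂) = 0`.  (For the wild twins of the slice: torsion `1`, `c₂ = 1`,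
Tam odd on 283/283 × 3; unit value ⟺ `#Ш_an` odd, 620/620 on `β = 1`.)  Not in print at `p = 2` (Kato 2004 Thm. 17.4 / Perrin-Riou 2003 Prop. 4.8 are stated
for the relevant `p` odd or good); -es `KatoRankZeroUpperBoundAtTwo` is the GOOD-supersingular sibling.  REF1 §111: SURVIVES conjecture-grade (BSD₂ of the
rank-0 wild twin; Kato at additive 2), tagged `@[conjecture]` (r4, typer edit); r1 (not blocking, -an's call): as typed the hypothesis is
`¬ HasGoodReductionAtPrime 2` — MULTIPLICATIVE at `2` included — which is MORE than the name/prose «additive» (the additive restriction is the weaker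
statement; BSD₂-implied in both readings; the census covers additive twins only, `c₂ = 1`); a restricted row, if wanted, goes under a NEW name (append-only).
[cite: Kato2004Asterisque, Thm. 12.5, Thm. 17.4] -/
@[conjecture] def AdditiveUnitValueKillsSelmerTwoAtTwo : Prop :=
  ∀ (W₂ : WeierstrassCurve ℚ) [W₂.IsElliptic] [W₂.IsGloballyMinimal], ¬ W₂.HasGoodReductionAtPrime 2 →
    Kato2004.ImageContainsSL2 W₂ 2 → Odd W₂.torsionOrder → Odd W₂.tamagawaProduct → W₂.analyticRank = 0 →
    (∃ q : ℚ, W₂.entireLFunction 1 / (W₂.realPeriodRat : ℂ) = (q : ℂ) ∧ padicValRat 2 q = 0) → selmerTwoCard W₂ = 1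

/-- **AN-32↑ `UBottomOnPrimitiveLocusAtTwo`** — the U half's bottom rung on `{β = 1}`, Heegner-free: on the good-supersingular odd-Tam slice with
`ρ_{E,2^∞}` onto, rank one and `β = 1`, if the additive twin `E^{(2)}` has analytic rank `0` with unit value `L(E^{(2)},1)/Ω = L(E,χ₈,1)/Ω`, odd torsion and odd
Tamagawa product, then `Ш(E)[2] = 0`.  PROVED below from AN-32U + AN-32K + the two supports. -/
def UBottomOnPrimitiveLocusAtTwo : Prop :=
  ∀ (W : WeierstrassCurve ℚ) [W.IsElliptic] [W.IsGloballyMinimal], GoodSS W 2 → Odd W.tamagawaProduct →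
    (∀ n : ℕ, W.HasSurjectiveModNGaloisRep ((2 ^ n : ℕ) : ℤ)) → W.mordellWeilRank = 1 → LocallyPrimitiveAtTwo W →
    ∀ (W₂ : WeierstrassCurve ℚ) [W₂.IsElliptic] [W₂.IsGloballyMinimal] (C : WeierstrassCurve.VariableChange ℚ),
      C • W.quadraticTwist (2 : ℚ) = W₂ → ¬ W₂.HasGoodReductionAtPrime 2 → Odd W₂.torsionOrder → Odd W₂.tamagawaProduct →
      W₂.analyticRank = 0 → (∃ q : ℚ, W₂.entireLFunction 1 / (W₂.realPeriodRat : ℂ) = (q : ℂ) ∧ padicValRat 2 q = 0) → ShaTwoTrivial W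

/-- Kernel glue (PROVED, -an g15): AN-32U + AN-32K + the model/image supports AN-32M, AN-32i ⟹ AN-32↑ (U's bottom rung on `{β = 1}`, Heegner-free). -/
theorem uBottomOnPrimitiveLocus_of (hU : ShaTwoReadByWildTwinAtTwo) (hK : AdditiveUnitValueKillsSelmerTwoAtTwo)
    (hM : TwistSelmerModelInvarianceAtTwo) (hI : TwinImageContainsSL2AtTwo) : UBottomOnPrimitiveLocusAtTwo := by
  intro W _ _ hss htam hsurj hrk hβ W₂ _ _ C hC hadd htors htam₂ han hunit
  have himg : Kato2004.ImageContainsSL2 W₂ 2 := hI W W₂ C hC hsurj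
  have hsel : selmerTwoCard W₂ = 1 := hK W₂ hadd himg htors htam₂ han hunit
  have hmodel : twistSelmerTwoCard W 2 = selmerTwoCard W₂ := hM W W₂ C hC
  exact (hU W hss htam hrk hβ).mpr (hmodel.trans hsel)

end Summit.BirchSwinnertonDyer.Rank1Residual.F1Sign2.WildPacket

end
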